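import Summits.CriticalPhenomena.Ising3DConformalLimit.Theorems.ExistsScaleCovariantLimit.Negative.DyadicIdentity
import HarnessLib

/-!
# Tightness ⟹ pointwise eventual boundedness of the pinned zoom
(line `Sketch` of the crux `ExistsScaleCovariantLimit`, item stmt-CriticalPhenomena-1981;
stub `stub_pointwiseBounded_of_tight`, glue B)

Pure real-analysis glue. The pinned zoom of the critical `ℤ³` Ising correlators is
`F_n(δ)(x) = rescaledCorrelator (criticalCorr 3) rhoPin n δ x`. Assume TIGHTNESS: every mesh sequence
`u k ∈ (0,1]`, `u → 0⁺`, has a subsequence along which the zoom converges locally uniformly on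
`NonCoincident 3 n`, for all `n` simultaneously. Then at every non-coincident configuration `x` the
values `F_n(δ)(x)` stay bounded as `δ → 0⁺` (eventually along the filter `𝓝[>] 0`).

Proof by contradiction: if no bound `M` works, then for every `k : ℕ` the set of `δ` with
`k < |F_n(δ)(x)|` is frequent near `0⁺`, so one can choose `δ_k ∈ (0, 1/(k+1))` with
`k < |F_n(δ_k)(x)|`. The sequence `δ_k` lies in `(0,1]` and tends to `0⁺`; tightness extracts a
subsequence `φ` along which `F_n(δ_{φ k})(x)` converges (`TendstoLocallyUniformlyOn.tendsto_at`), hence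
is eventually bounded in absolute value by some `C`; but `|F_n(δ_{φ k})(x)| > φ k ≥ k`, absurd for
`k > C`. No named facts. [folklore]
-/

noncomputable section

namespace Summit.CriticalPhenomena.Ising3DConformalLimit.Cruxes.ExistsScaleCovariantLimit.TwoHierarchies

open Literature.Probability.LatticeModels Filter Set
open scoped Topology
open Summit.CriticalPhenomena.Ising3DConformalLimit.MoebiusLimitExistsOnlyInteraction (rhoPin)

/-- **B — glue: tightness ⟹ pointwise eventual boundedness** of the pinned zoom
`δ ↦ rescaledCorrelator (criticalCorr 3) rhoPin n δ x` at every non-coincident configuration `x` as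
`δ → 0⁺`: if `|F_n(δ_k)(x)| → ∞` along some `δ_k → 0⁺`, no subsequence could converge at `x`
(`TendstoLocallyUniformlyOn.tendsto_at` + `Filter.Tendsto.isBoundedUnder_le`). [folklore] -/
theorem stub_pointwiseBounded_of_tight :
    (∀ u : ℕ → ℝ, (∀ k, u k ∈ Set.Ioc (0:ℝ) 1) → Tendsto u atTop (𝓝[>] (0:ℝ)) →
      ∃ φ : ℕ → ℕ, StrictMono φ ∧ ∃ S : CorrFamily 3, ∀ n,
        TendstoLocallyUniformlyOn (fun k => rescaledCorrelator (criticalCorr 3) rhoPin n (u (φ k)))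
          (S n) atTop (NonCoincident 3 n)) →
    ∀ n : ℕ, ∀ x ∈ NonCoincident 3 n, ∃ M : ℝ,
      ∀ᶠ δ in 𝓝[>] (0:ℝ), |rescaledCorrelator (criticalCorr 3) rhoPin n δ x| ≤ M := by
  intro htight n x hx
  by_contra hnot
  rw [not_exists] at hnot
  -- for every `k`, a mesh `δ ∈ (0, 1/(k+1))` with `k < |F_n(δ)(x)|`
  have hfreq : ∀ k : ℕ, ∃ δ : ℝ, δ ∈ Set.Ioo (0:ℝ) (1 / ((k:ℝ) + 1)) ∧
      (k:ℝ) < |rescaledCorrelator (criticalCorr 3) rhoPin n δ x| := by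
    intro k
    have h1 : ∃ᶠ δ in 𝓝[>] (0:ℝ), (k:ℝ) < |rescaledCorrelator (criticalCorr 3) rhoPin n δ x| :=
      (Filter.not_eventually.1 (hnot k)).mono fun δ hδ => not_le.1 hδ
    have h2 : ∀ᶠ δ in 𝓝[>] (0:ℝ), δ ∈ Set.Ioo (0:ℝ) (1 / ((k:ℝ) + 1)) :=
      Ioo_mem_nhdsGT (by positivity)
    obtain ⟨δ, hδ1, hδ2⟩ := (h1.and_eventually h2).exists
    exact ⟨δ, hδ2, hδ1⟩
  choose u hu_mem hu_gt using hfreq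
  -- the chosen meshes form an admissible sequence: in `(0,1]`, tending to `0⁺`
  have hu_Ioc : ∀ k, u k ∈ Set.Ioc (0:ℝ) 1 := by
    intro k
    refine ⟨(hu_mem k).1, ?_⟩
    have hle : 1 / ((k:ℝ) + 1) ≤ 1 := by
      rw [div_le_one (by positivity)]
      linarith [(Nat.cast_nonneg k : (0:ℝ) ≤ k)]
    exact ((hu_mem k).2.le).trans hle
  have hu_tend : Tendsto u atTop (𝓝[>] (0:ℝ)) := by
    rw [tendsto_nhdsWithin_iff]
    refine ⟨?_, Filter.Eventually.of_forall fun k => (hu_mem k).1⟩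
    exact tendsto_of_tendsto_of_tendsto_of_le_of_le tendsto_const_nhds
      tendsto_one_div_add_atTop_nhds_zero_nat (fun k => (hu_mem k).1.le) (fun k => (hu_mem k).2.le)
  -- tightness: a subsequence along which the zoom converges at `x`, hence is eventually bounded
  obtain ⟨φ, hφ, S, hS⟩ := htight u hu_Ioc hu_tend
  have hconv : Tendsto (fun k => rescaledCorrelator (criticalCorr 3) rhoPin n (u (φ k)) x) atTop
      (𝓝 (S n x)) := (hS n).tendsto_at hx
  obtain ⟨C, hC⟩ := hconv.abs.isBoundedUnder_le
  have hC' : ∀ᶠ k in atTop, |rescaledCorrelator (criticalCorr 3) rhoPin n (u (φ k)) x| ≤ C :=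
    Filter.eventually_map.1 hC
  -- but `|F_n(u (φ k))(x)| > φ k ≥ k`: contradiction for `k > C`
  obtain ⟨N, hN⟩ := exists_nat_gt C
  obtain ⟨k, hk1, hk2⟩ := (hC'.and (eventually_ge_atTop N)).exists
  have hgt := hu_gt (φ k)
  have hφk : (k:ℝ) ≤ (φ k : ℝ) := by exact_mod_cast hφ.id_le k
  have hNk : (N:ℝ) ≤ (k:ℝ) := by exact_mod_cast hk2
  linarith

end Summit.CriticalPhenomena.Ising3DConformalLimit.Cruxes.ExistsScaleCovariantLimit.TwoHierarchies

end
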